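import Summits.HodgeConjecture.CorCM.Hyp413.A3Liu413RogawskiFaceTypes
import Summits.HodgeConjecture.HodgeConjecture.Theorems.A3Liu413StubG2Holds
import Summits.HodgeConjecture.HodgeConjecture.Theorems.A3Liu413DictionaryStubsByName
import HarnessLib

/-!
# `StubFTF1'` ⇐ FLOOR — (T4) F-TF1′ at the pin FROM row III-2 (a) `hdictE` + ★ G2 (⇒) + ★ `epsCofinite_of_parity`

Cell `hodgecm-mathlib` (D-0151), fan B-III (T4) «Rogawski 1990 for OUR inner form G′ → the h413 rows», item h413 = stmt-HodgeConjecture-24833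
(`--supports`; registry of record = A-plan2's `Cruxes/H413/Lines/a3_liu413.lean` v10.1, served T4 stub `stub_FTF1' : StubFTF1'`); KEY
`wake/KEY-hodgecm-mathlib-B-p16-t4-ka-ftf1-of-floor.md` (B-plan2 g4, director g4 RULING s61 (1)).

WHAT THIS FILE IS — AND IS NOT.  `StubFTF1'` (`CorCM/Hyp413/A3Liu413RogawskiFaceTypes.lean` :230) is Rogawski's trace-formula statement F-TF1′
(«at `n = 3`, every irreducible `U(V)(𝔸_{F⁺,f})`-representation occurring in the PIN's `H¹_{B,τ′}(A_∞, ℂ)` is `≅ ω_V(t)` for SOME triple `t` with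
`EpsCofinite t ∧ t.HasWeightOne`»), a FACT ∞ from Mathlib (ROG-SPEC §2 TF chain).  What is closed HERE is the implication **T4 ⇐ FLOOR**: the floor row
III-2 (a) `hdictE` (= the registered fact-level stub `stub_oscillatorTriple_dictionaryExistence`, text token for token), through ★
`stub_dictionaryExistenceAtPin_of_dictionaryExistence` (A-p07, E-III2), gives MORE — an ADMISSIBLE weight-one `t' : P.AdmTriple` with `σ ≅ ω_{t'}`;
admissible ⇒ `Parity` (★ `stubG2_holds` (A-p05), `.mp`) ⇒ `EpsCofinite` (★ `epsCofinite_of_parity`).  Census line: «FTF1′ ⇐ hdictE + G2(⇒):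
the T4 existence half ≤ the floor existence half».  Closing the served stub this way shrinks 24833's served set and certifies that the T4 edition asks
NO MORE than the floor; it does NOT reduce the floor {hF1e, hdictE, hJ3a, hocc, hFal, h415} and is not a new citation — the floor-reducing direction
(FLOOR ⇐ Rogawski TF) stays the B-III DAG, planners-only.  The head takes the floor FACT TEXT as a HYPOTHESIS (never `sorry`, never the Cruxes
workfile).  HC_CM is proved only modulo the 7 printed citations until rung 0 closes.

## References
* [Rogawski1990] J. D. Rogawski, *Automorphic Representations of Unitary Groups in Three Variables*, Ann. of Math. Stud. 123 (1990), §15.3 ¶1 (pp. 249–250).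
* [GelbartRogawski1991] S. Gelbart, J. Rogawski, Invent. Math. 105 (1991), Thm. 5.1.1 (p. 465), Lemma 5.1.2.
* [Liu2021] Y. Liu, Camb. J. Math. 9 (2021) = arXiv:2102.11518: Def. 4.11 (l. 2088), Def. 4.12 (ll. 2102–2108), Rem. 4.14, proof of Prop. 4.13 (l. 2145).
* Tree: `CorCM/Hyp413/A3Liu413RogawskiFaceTypes.lean` (`StubFTF1'`, `Parity`, `EpsCofinite`, `epsCofinite_of_parity`, `StubG2`);
  `Theorems/A3Liu413StubG2Holds.lean` (`stubG2_holds`); `Theorems/A3Liu413DictionaryStubsByName.lean` (`stub_dictionaryExistenceAtPin_of_dictionaryExistence`).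
-/

set_option autoImplicit false

-- `Summit.HodgeConjecture.HodgeConjecture.Theorems` (summit = sub-problem, D-0017 single-conjunct layout) is what
-- `linter.dupNamespace` flags; the lakefile turns the linter off tree-wide (weak option), restated here so stand-alone elaboration is
-- warning-free (same line as `Theorems/HCCMUnconditionalH21.lean`).
set_option linter.dupNamespace false

noncomputable section

namespace Summit.HodgeConjecture.HodgeConjecture.Theorems

open scoped TensorProduct Matrix
open NumberField NumberField.InfinitePlace
open HodgeCM.Model HodgeCM.Model.LiuIndex HodgeCM.Model.TowerCarrier
open Summit.HodgeConjecture.CorCM Summit.HodgeConjecture.CorCM.Model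
open Summit.HodgeConjecture.CorCM.Lines.A3Liu413
open Literature.AlgebraicGeometry.Motives (CMType)
open Literature.AlgebraicGeometry.HodgeTheory Literature.NumberTheory.Automorphic.PicardCM
open Literature.AlgebraicGeometry.ShimuraVarieties.UnitaryCanonicalModel
open Literature.NumberTheory.ComplexMultiplication
open Literature.NumberTheory.Automorphic
open Literature.NumberTheory.Automorphic.Liu2021 Literature.NumberTheory.Automorphic.Liu2021.AppendixC
open Literature.NumberTheory.Automorphic.Liu2021.AppendixC.RestOne
open Literature.NumberTheory.Automorphic.Liu2021.Def411WeilCarriers (lineOf locF Rep)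
open Summit.HodgeConjecture.CorCM.Transposition.OmegaTransport (realUnit)
open HodgeCM.Model.ArchSideTerm (e₁)
open Literature.NumberTheory.GelbartRogawski1991 Literature.NumberTheory.GelbartRogawski1991.UnitaryDualPair
open Literature.RepresentationTheory Literature.RepresentationTheory.Liu2021
open Summit.HodgeConjecture.CorCM.Transposition
open scoped DirectSum
open Literature.NumberTheory.GelbartRogawski1991.OscillatorTripleDictionary (OccursInH1 IsIsoToOmega)

set_option synthInstance.maxHeartbeats 400000 in
set_option maxHeartbeats 8000000 in
/-- **`StubFTF1'` ⇐ FLOOR (T4 ⇐ floor; K-a′).**  If row III-2 (a)'s EXISTENCE record `oscillatorTriple_dictionaryExistence` ([GR91] Thm 5.1.1 in Liu's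
labels, existence half) holds at the printed datum `P(F, V, a₀, Φ, i)` of every face (`hdictE`, = the floor binder / the registered fact-level stub
`stub_oscillatorTriple_dictionaryExistence` token for token), then the served T4 stub type `StubFTF1'` (F-TF1′, [Rogawski1990, §15.3 ¶1] with
[Liu2021, Def. 4.11]'s cofiniteness proviso) holds: the floor gives an ADMISSIBLE weight-one `t'` with `σ ≅ ω_V(t')`
(★ `stub_dictionaryExistenceAtPin_of_dictionaryExistence`), admissible ⇒ `Parity t'` (★ `stubG2_holds`, [Liu2021, Def. 4.12] ⟺ parity), and
`Parity t' → EpsCofinite t'` (★ `epsCofinite_of_parity`); take `t := t'.1`.  «FTF1′ ⇐ hdictE + G2(⇒): the T4 existence half ≤ the floor existence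
half» — no floor change, not a citation.  HC_CM is proved only modulo the 7 printed citations until rung 0 closes.
[cite: Rogawski1990, §15.3 (pp. 249–250)] [cite: GelbartRogawski1991, Thm. 5.1.1 (p. 465)] [cite: Liu2021, Def. 4.11 (l. 2088); Def. 4.12 (ll. 2102–2108); Rem. 4.14] -/
theorem stubFTF1'_of_floor
    (hdictE :
    ∀ (hDel : Literature.AlgebraicGeometry.ShimuraVarieties.UnitaryCanonicalModel.canonicalModel_exists_printed)
      (F : HodgeCM.CMField) [IsGalois ℚ F] (h6 : 6 ≤ Module.finrank ℚ F) {ι₁ : F →+* ℂ} (V : HodgeCM.HermSpace3 F ι₁) (a₀ : RealScalar F)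
      (Φ : CMType F) (hΦ : ι₁ ∈ Φ.1) (i : (I V (repAt a₀) (muLiu ι₁ GramClass.rep))),
      oscillatorTriple_dictionaryExistence (((uniformOmegaRep (Summit.HodgeConjecture.CorCM.DelRec.exists_recordSystem_of_printed hDel) ⟨HodgeCM.CMField.K F⟩ ι₁ ⟨HodgeCM.HermSpace3.Hm V, HodgeCM.HermSpace3.isHermitian V, HodgeCM.HermSpace3.signature_ι₁ V, HodgeCM.HermSpace3.posDef_of_ne V⟩ Φ e₁ (frameD V) (frameD_real V) (frameD_ne V) (ιVE V) (2 * imagUnit (HodgeCM.CMField.K F))⁻¹ (fun _ _ => (Rep.update ↥(maximalRealSubfield (HodgeCM.CMField.K F)) (imagUnitSq (HodgeCM.CMField.K F)) (Rep.ofLineOf ↥(maximalRealSubfield (HodgeCM.CMField.K F)) (imagUnitSq (HodgeCM.CMField.K F))) (locF ↥(maximalRealSubfield (HodgeCM.CMField.K F)) (imagUnitSq (HodgeCM.CMField.K F)) (realUnit ⟨HodgeCM.CMField.K F⟩ (repAt a₀ (Sigma.fst i)).1 (repAt a₀ (Sigma.fst i)).2.1 (repAt a₀ (Sigma.fst i)).2.2))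 (realUnit ⟨HodgeCM.CMField.K F⟩ (repAt a₀ (Sigma.fst i)).1 (repAt a₀ (Sigma.fst i)).2.1 (repAt a₀ (Sigma.fst i)).2.2) rfl)))).prop413Data ((liuDictionaryPin exists_isReal_hodgeModel_holds hodgePQ_independent_of_hodgeModel_holds BallQuotient.ballQuotientUniformised_holds (cmAbelianVarietyRealised_of_eigenbasis exists_isReal_hodgeModel_holds hodgePQ_independent_of_hodgeModel_holds cmAbelianVarietyEigenbasisRealised_holds) Literature.NumberTheory.Transcendental.arapura2012_cor_15_4_6_holds V (I V (repAt a₀) (muLiu ι₁ GramClass.rep)) (line V (repAt a₀) (muLiu ι₁ GramClass.rep)))).H)) :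
    StubFTF1' := by
  intro hDel F _ h6 ι₁ V a₀ Φ hΦ i hn τ' W₀ _ _ σ hirr hocc
  obtain ⟨t', ht'⟩ :=
    stub_dictionaryExistenceAtPin_of_dictionaryExistence hdictE hDel F h6 V a₀ Φ hΦ i hn τ' W₀ σ hirr hocc
  exact ⟨t'.1, epsCofinite_of_parity hDel F V a₀ Φ i t'.1 ((stubG2_holds hDel F h6 V a₀ Φ hΦ i t'.1).mp t'.2.2), t'.2.1, ht'⟩

end Summit.HodgeConjecture.HodgeConjecture.Theorems

end
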